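import Literature.AnabelianGeometry.EtaleTheta.SettingModelChiCyclotomes
import Literature.AnabelianGeometry.EtaleTheta.XuuCocycleNormal
import HarnessLib

/-!
# The χ-twisted root model of [EtTh] §1 (R78 (B)), row #5 continued: the choice `X̲̲` (Def. 2.5 (i)) EXISTS at
# `ThetaSetting.modelχ p` from the Kummer-layer inputs alone — the cyclotome input and the freeness guard are THEOREMS

Mochizuki, *The Étale Theta Function …* [EtTh], Publ. RIMS **45** (2009), Def. 2.5 (i) p. 39 (the curve `X̲̲`
of type `(1, (ℤ/lℤ)^Θ)`), Def. 2.7 p. 41, Prop. 1.5 (ii)/(iii) p. 23 (PRIMS PDF pages).  Cell abc-iut, layer L2,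
seat abc-iut-L2-t8 (owner of `DoubleUnderline.lean` and of the §1 → §2 adapter); R78 cluster row #5 «t8 adapter
layer at the χ-twisted model» (L2-lead RULINGS #13 R116).  PROOF-ONLY (0 definitions).

abc-iut-L2-t7's `nonempty_doubleUnderline_of_sectionOneFacts` / `exists_doubleUnderline_normal_of_sectionOneFacts`
(`XuuCocycleOfSectionOneFacts.lean` / `XuuCocycleNormal.lean`) produce the choice `X̲̲` (`E.DoubleUnderline l`,
Def. 2.5 (i)) over ANY theta setting from: `Compat`, `Sec2Hyps`, the guard `IsEtThOrigin`, the §1 facts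
`Prop15iii` / `Prop15ii` (F-0591 / F-2503), a cyclotome input `μ : D.CyclotomeMod 1 l` and `l` odd.  AT THE
χ-TWISTED MODEL two of these are now THEOREMS — the guard (abc-iut-L2-t1, `modelχ_isEtThOrigin`) and the cyclotome
input (this seat, `modelχ_nonempty_cyclotomeMod`, over abc-iut-L6-d6's `Δ_Θ ≅ Ẑ(χ)` coordinates) — so `X̲̲`
exists at `modelχ` for every étale theta datum `E` satisfying the KUMMER-LAYER inputs only
(`modelχ_nonempty_doubleUnderline`), and is normal in `Π^tp_{X̲}` when moreover `μ_l ⊆ K`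
(`modelχ_exists_doubleUnderline_normal`).  The remaining binders `E : (modelχ p).EtaleThetaData`, `Compat`,
`Sec2Hyps`, `Prop15iii`, `Prop15ii` are the R78 Kummer files F6 (abc-iut-w5-d171), F7 (abc-iut-L2-t6), L2-d1's
`modelχ_sec2Hyps` and the Prop. 1.5 root theorems of abc-iut-L6-d5 / abc-iut-L2-t12 — consumed BY NAME when
they land (abc-iut-L2-d1's `SettingModelChiDoubleUnderline.lean` builds the EXPLICIT `X̲̲` of the χ-model — `Huuχ = dUU ⋊_χ G_{ℚ_p}` —
E-free; the present file is the complementary FACTS route, for EVERY `E` over `modelχ`); with `X̲̲` in hand the §2 objects of this seat's adapter (`thetaCocycles`, `thetaEnvData`, `thetaEnvTower`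
over `modelχ_nonempty_cyclotomeTower`, `rigidData`) are DEFINED terms.  HONEST LABEL: semi-synthetic model —
consistency evidence for the typed interface; nothing of [EtTh] asserted; no side taken on [IUTchIII] Cor. 3.12.
-/

noncomputable section

namespace Literature.AnabelianGeometry.EtaleTheta.SettingModel

open Literature.AnabelianGeometry.SemiGraphs

variable (p : ℕ) [Fact p.Prime]

/-- **A cyclotome input `μ : CyclotomeMod 1 l` EXISTS at the χ-twisted model** (the `l = 1` level of row #5's
family). [cite: MochizukiEtTh2009, Def 2.13 p.46] -/
theorem modelχ_nonempty_cyclotomeMod_one (l : ℕ+) : Nonempty ((ThetaSetting.modelχ p).CyclotomeMod 1 l) :=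
  modelχ_nonempty_cyclotomeMod p Nat.one_pos l

/-- **`X̲̲` EXISTS at the χ-twisted model from the Kummer-layer inputs alone** (Def. 2.5 (i): a choice
`E.DoubleUnderline l` for every étale theta datum `E` over `modelχ` with `Compat`, `Sec2Hyps`, Prop. 1.5 (iii),
Prop. 1.5 (ii), and `l` odd) — the guard `IsEtThOrigin` and the cyclotome input `CyclotomeMod 1 l` of
abc-iut-L2-t7's `nonempty_doubleUnderline_of_sectionOneFacts` being THEOREMS here.
[cite: MochizukiEtTh2009, Def 2.5 (i) p.39] -/
theorem modelχ_nonempty_doubleUnderline {E : (ThetaSetting.modelχ p).EtaleThetaData}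
    (hC : (ThetaSetting.modelχ p).Compat) (hS : (ThetaSetting.modelχ p).Sec2Hyps)
    (h15 : ThetaSetting.Prop15iii E hC) (h15ii : ThetaSetting.Prop15ii E.toKummerData hC)
    {l : ℕ+} (hl : Odd (l : ℕ)) : Nonempty (E.DoubleUnderline l) := by
  obtain ⟨μ⟩ := modelχ_nonempty_cyclotomeMod_one p l
  exact ThetaSetting.EtaleThetaData.nonempty_doubleUnderline_of_sectionOneFacts hC hS
    (ThetaSetting.modelχ_isEtThOrigin p) h15 h15ii μ hl

/-- **… and `X̲̲ → X̲` is GALOIS when `μ_l ⊆ K`** (abc-iut-L2-t7's `exists_doubleUnderline_normal_of_sectionOneFacts`;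
at `modelχ`, `K = ℚ_p`, so the clause holds iff `l ∣ p − 1`). [cite: MochizukiEtTh2009, Def 2.5 (i) p.39] -/
theorem modelχ_exists_doubleUnderline_normal {E : (ThetaSetting.modelχ p).EtaleThetaData}
    (hC : (ThetaSetting.modelχ p).Compat) (hS : (ThetaSetting.modelχ p).Sec2Hyps)
    (h15 : ThetaSetting.Prop15iii E hC) (h15ii : ThetaSetting.Prop15ii E.toKummerData hC)
    {l : ℕ+} (hl : Odd (l : ℕ))
    (hμK : ∀ ζ : MuN p l, (((ζ : (PadicAlgCl p)ˣ) : PadicAlgCl p)) ∈ (ThetaSetting.modelχ p).K) :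
    ∃ C : E.DoubleUnderline l, (C.Huu.subgroupOf ((ThetaSetting.modelχ p).GtpXu l)).Normal := by
  obtain ⟨μ⟩ := modelχ_nonempty_cyclotomeMod_one p l
  exact ThetaSetting.EtaleThetaData.exists_doubleUnderline_normal_of_sectionOneFacts hC hS
    (ThetaSetting.modelχ_isEtThOrigin p) h15 h15ii μ hl hμK

end Literature.AnabelianGeometry.EtaleTheta.SettingModel

end
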